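import Summits.QuantumFields.YangMills.Theorems.LuscherReductionRunningReductionValleyAxial
import HarnessLib

/-!
# Guards on the typed S-BASE sub-targets of record C3 / C4 (`ValleyRowBoundAt`, `ValleyGainAt`, `InnerNoIntruderAxialAt`,
# `InnerNoIntruderOneOrbitAt`, `InnerNoIntruderAt`, `BOUpperAt`) — crux disprover, cycle 6
# (route `LuscherReduction`, crux `TwistedTraceScaling` stmt-QuantumFields-20203, skeleton «twolattice» rev 3, stub S-BASE; `--supports`, helper only)

The fixed-lattice lane of S-BASE (`pub/ym-fleet/ym-luscher-20007-p1`) reduced COARSE-UPPER(L) to the two OPEN typed texts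
`ValleyRowBoundAt L δ η` (C3, axial VALLEY ROW BOUND) and `InnerNoIntruderAxialAt L δ` (C4, axial INNER NO-INTRUDER) of
`…RunningReductionValleyAxial` (`coarseNoIntruderAt_of_axial_pow`, scales `δ = η = β^{−p}`, `0 < p < 1/3`), via the intermediate texts
`ValleyGainAt` / `InnerNoIntruderOneOrbitAt` / `InnerNoIntruderAt` / `BOUpperAt` (`…CoarseUpperDefs`, `…CoarseUpperCopies`).
This file records, kernel-checked, which clauses of those texts are LOAD-BEARING and which are decoration — the standing disprover's
hypothesis-mutation pass on the new targets (no kill: all texts are consistent on paper, see the crux workfile `Cruxes/TwistedTraceScaling/Disproof.lean` §(I)):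
* §1 `le_levelValue_of_family` — the Courant–Fischer lower-bound principle in the FAMILY form used by the no-intruder texts
  (a Gram-nondegenerate physical `(k+1)`-family all of whose combinations have Rayleigh quotient `≥ s` forces `s ≤ λ_k`);
* §2 ★ `valleyGain_false_without_support`, `valleyRowBound_false_without_region` — the SUPPORT clause of V(L) / the REGION restriction of C3
  is load-bearing: with it deleted the `A`-clause fails for every `A > 0`, every `L`, eventually-in-`β` or not (the top value `λ₀` is a supremum
  over all physical test functions; a region-free row super-solution bounds it through the axial Schur door `qform_le_of_axialRow`);
* §3 `innerNoIntruderAt_iff_dropGram`, `innerNoIntruderOneOrbitAt_iff_dropGram`, `innerNoIntruderAxialAt_iff_dropGram` — the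
  GRAM-NONDEGENERACY hypothesis of all three no-intruder texts is FREE (a degenerate combination vanishes a.e., both sides are `0`);
* §4 degenerate instances that are TRUE (normalisation audit of the texts): the `k = 0` clauses of `BOUpperAt L` and `InnerNoIntruderAt L δ`
  hold for every `L`, `δ` (`boUpper_level_zero`, `innerNoIntruder_level_zero`: the trial-function bound `⟨ψ,Kψ⟩ ≤ λ₀‖ψ‖²`), and at `L = 1`
  (the one-site lattice IS the one-site model at `B' = 1³β = β`) `boUpperAt_one : BOUpperAt 1` and `innerNoIntruderAt_one : ∀ δ, InnerNoIntruderAt 1 δ`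
  (the latter is exactly the max–min principle of §1 — the support clause is void there);
* §5 monotonicity in the scale: `innerNoIntruderAt_anti`, `innerNoIntruderOneOrbitAt_anti`, `innerNoIntruderAxialAt_anti` (a smaller box is
  easier), `valleyGainAt_mono` (a smaller valley is easier) — bookkeeping for provers who shift `p`.
HONEST FRAMING: negative/structural lemmas about OPEN target texts of a stub (S-BASE) of a child of the CONDITIONAL reduction route R2b1
(femto rung); nothing here proves or refutes C3/C4; not infinite volume, not a mass gap, not Clay.
-/

set_option autoImplicit false

noncomputable section

open MeasureTheory Filter Topology Real
open scoped Matrix BigOperators Matrix.Norms.Frobenius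
open Literature.MathematicalPhysics.QuantumFieldTheory hiding SU2
open Literature.MathematicalPhysics.QuantumLattice
open Summit.QuantumFields.YangMills.Theorems.FemtoTransferGap

namespace Summit.QuantumFields.YangMills.Theorems.TwistedTraceScaling.Negative.R6

variable {L : ℕ} [NeZero L]

/-! ## §0 Two measure-theoretic trivialities -/

/-- On a finite measure space a bounded measurable `u` with `¬ 0 < ∫ u·u` vanishes almost everywhere. [folklore] -/
theorem ae_eq_zero_of_not_integral_mul_self_pos {X : Type*} [MeasurableSpace X] {μ : Measure X} [IsFiniteMeasure μ]
    {u : X → ℝ} (hm : Measurable u) {C : ℝ} (hb : ∀ x, |u x| ≤ C) (h : ¬ 0 < ∫ x, u x * u x ∂μ) :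
    u =ᵐ[μ] 0 := by
  have hint : Integrable (fun x => u x * u x) μ := by
    refine Integrable.mono' (integrable_const (C * C)) (hm.mul hm).aestronglyMeasurable (ae_of_all _ fun x => ?_)
    rw [Real.norm_eq_abs, abs_mul]
    exact mul_le_mul (hb x) (hb x) (abs_nonneg _) ((abs_nonneg _).trans (hb x))
  have h0 : ∫ x, u x * u x ∂μ = 0 := le_antisymm (not_lt.mp h) (integral_nonneg fun x => mul_self_nonneg (u x))
  have hae : (fun x => u x * u x) =ᵐ[μ] 0 :=
    (integral_eq_zero_iff_of_nonneg (fun x => mul_self_nonneg (u x)) hint).mp h0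
  filter_upwards [hae] with x hx
  simpa using hx

/-- If `u = 0` a.e. then `∫∫ u(x) K(x,y) u(y) = 0` for every kernel `K`. [folklore] -/
theorem integral_integral_eq_zero_of_ae_eq_zero {X : Type*} [MeasurableSpace X] {μ : Measure X} {u : X → ℝ} (hu : u =ᵐ[μ] 0)
    (K : X → X → ℝ) : ∫ x, ∫ y, u x * K x y * u y ∂μ ∂μ = 0 := by
  have hin : ∀ x, ∫ y, u x * K x y * u y ∂μ = 0 := fun x => by
    have e : (fun y => u x * K x y * u y) =ᵐ[μ] fun _ => 0 := by
      filter_upwards [hu] with y hy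
      simp [hy]
    rw [integral_congr_ae e, integral_zero]
  simp [hin]

/-- If `u = 0` a.e. then `∫ u·u = 0`. [folklore] -/
theorem integral_mul_self_eq_zero_of_ae_eq_zero {X : Type*} [MeasurableSpace X] {μ : Measure X} {u : X → ℝ} (hu : u =ᵐ[μ] 0) :
    ∫ x, u x * u x ∂μ = 0 := by
  have e : (fun x => u x * u x) =ᵐ[μ] fun _ => 0 := by
    filter_upwards [hu] with x hx
    simp [hx]
  rw [integral_congr_ae e, integral_zero]

/-! ## §1 The lower-bound (max–min) principle in family form -/

/-- **Courant–Fischer lower bound, family form.**  If `F₀,…,F_k` are physical with nondegenerate Gram matrix and every combination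
`ψ = Σ aᵢFᵢ` satisfies `s‖ψ‖² ≤ ⟨ψ,K_βψ⟩`, then `s ≤ λ_k(β,L)`. [cite: ReedSimonIV1978, Thm. XIII.1] -/
theorem le_levelValue_of_family {k : ℕ} (β : ℝ) {s : ℝ} (F : Fin (k + 1) → GaugeConfig 3 L SU2 → ℝ) (hF : ∀ i, IsPhys (F i))
    (hGram : ∀ a : Fin (k + 1) → ℝ, a ≠ 0 → 0 < l2 (fun U => ∑ i, a i * F i U) (fun U => ∑ i, a i * F i U))
    (hs : ∀ a : Fin (k + 1) → ℝ, s * l2 (fun U => ∑ i, a i * F i U) (fun U => ∑ i, a i * F i U) ≤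
      qform su2Rep β (fun U => ∑ i, a i * F i U) (fun U => ∑ i, a i * F i U)) :
    s ≤ levelValue su2Rep L β k := by
  have hcomb : ∀ a : Fin (k + 1) → ℝ, (∑ i, a i • F i) = fun U => ∑ i, a i * F i U := fun a => by
    funext U; simp [Finset.sum_apply, smul_eq_mul]
  have hli : LinearIndependent ℝ F := by
    rw [Fintype.linearIndependent_iff]
    intro a ha
    by_contra hne
    push Not at hne
    have ha0 : a ≠ 0 := by
      obtain ⟨i, hi⟩ := hne
      intro h; exact hi (by simp [h])
    have hpos := hGram a ha0
    rw [← hcomb a, ha] at hpos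
    simp [l2] at hpos
  set W : Submodule ℝ (GaugeConfig 3 L SU2 → ℝ) := Submodule.span ℝ (Set.range F) with hW
  have hrank : Module.finrank ℝ W = k + 1 := by rw [hW, finrank_span_eq_card hli, Fintype.card_fin]
  have hmem : ∀ ψ ∈ W, ∃ a : Fin (k + 1) → ℝ, ψ = fun U => ∑ i, a i * F i U := fun ψ hψ => by
    obtain ⟨a, ha⟩ := (Submodule.mem_span_range_iff_exists_fun ℝ).mp hψ
    exact ⟨a, by rw [← ha, hcomb]⟩
  have hadm : ∀ ψ ∈ W, IsPhys ψ := fun ψ hψ => by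
    obtain ⟨a, rfl⟩ := hmem ψ hψ
    exact isPhys_sum_mul_lat Finset.univ F hF a
  have hl2 : ∀ ψ ∈ W, ψ ≠ 0 → 0 < l2 ψ ψ := fun ψ hψ hne => by
    obtain ⟨a, rfl⟩ := hmem ψ hψ
    refine hGram a fun h0 => hne ?_
    funext U; simp [h0]
  have hsW : ∀ ψ ∈ W, s * l2 ψ ψ ≤ qform su2Rep β ψ ψ := fun ψ hψ => by
    obtain ⟨a, rfl⟩ := hmem ψ hψ
    exact hs a
  exact le_levelValue_of_subspace su2Rep continuous_su2Rep β W hrank hadm hl2 hsW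

/-! ## §2 The support clause of V(L) / the region restriction of C3 are load-bearing -/

/-- ★ **V(L) without its support clause is false for every `A > 0`**: there is no `β0` beyond which EVERY physical `φ` satisfies
`⟨φ,K_βφ⟩ ≤ e^{−Aλ_b(L³β)}·λ₀(β,L)·‖φ‖²` — `λ₀` is the supremum of the physical Rayleigh quotients (`levelValue_zero_le_of_forall_rayleigh_le`)
and `λ₀ > 0`, `λ_b(L³β) > 0`.  (The valley restriction carries all the content of `ValleyGainAt`.) [folklore] -/
theorem valleyGain_false_without_support {A : ℝ} (hA : 0 < A) :
    ¬ (∃ β0 : ℝ, ∀ β : ℝ, β0 ≤ β → ∀ φ : GaugeConfig 3 L SU2 → ℝ, IsPhys φ →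
        qform su2Rep β φ φ ≤ Real.exp (-(A * bareLambda ((L : ℝ) ^ 3 * β))) * levelValue su2Rep L β 0 * l2 φ φ) := by
  rintro ⟨β0, hβ0⟩
  set β : ℝ := max β0 1 with hβdef
  have hβ1 : 1 ≤ β := le_max_right _ _
  have hL : (0 : ℝ) < L := by exact_mod_cast Nat.pos_of_ne_zero (NeZero.ne L)
  have hB : 0 < (L : ℝ) ^ 3 * β := by positivity
  have hlam : 0 < bareLambda ((L : ℝ) ^ 3 * β) := bareLambda_pos' hB
  have hΛ0 : 0 < levelValue su2Rep L β 0 := levelValue_zero_su2Rep_pos L β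
  have hs0 : 0 ≤ Real.exp (-(A * bareLambda ((L : ℝ) ^ 3 * β))) * levelValue su2Rep L β 0 := by positivity
  have hle : levelValue su2Rep L β 0 ≤ Real.exp (-(A * bareLambda ((L : ℝ) ^ 3 * β))) * levelValue su2Rep L β 0 :=
    levelValue_zero_le_of_forall_rayleigh_le su2Rep β hs0 fun ψ hψ _ => hβ0 β (le_max_left _ _) ψ hψ
  have h2 : Real.exp (-(A * bareLambda ((L : ℝ) ^ 3 * β))) < 1 := Real.exp_lt_one_iff.mpr (by nlinarith)
  nlinarith

/-- ★ **C3 without its region restriction is false for every `A > 0`**: no `Ad`-invariant weight `0 < c ≤ h ≤ C` on the non-tree links can satisfy the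
REGION-FREE row bound `∫ A_β(w,w') h(w') dw' ≤ e^{−Aλ_b(L³β)}·λ₀·h(w)` at every `w`, eventually in `β` (through the axial Schur door
`qform_le_of_axialRow` with `R = univ` it would give the support-free V(L) refuted above). [cite: Grafakos2009, App. A.2] -/
theorem valleyRowBound_false_without_region {A : ℝ} (hA : 0 < A) :
    ¬ (∃ β0 : ℝ, ∀ β : ℝ, β0 ≤ β →
        ∃ (h : (OffIdx L → SU2) → ℝ) (c C : ℝ), Measurable h ∧ 0 < c ∧ (∀ w, c ≤ h w) ∧ (∀ w, h w ≤ C) ∧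
          (∀ (k : SU2) (w : OffIdx L → SU2), h (fun i => k * w i * k⁻¹) = h w) ∧
          ∀ w, ∫ w', axialKernel β w w' * h w' ∂(Measure.pi fun _ : OffIdx L => haarProbability SU2)
              ≤ Real.exp (-(A * bareLambda ((L : ℝ) ^ 3 * β))) * levelValue su2Rep L β 0 * h w) := by
  rintro ⟨β0, hβ0⟩
  apply valleyGain_false_without_support (L := L) hA
  refine ⟨max β0 0, fun β hβ φ hφ => ?_⟩
  have hβ' : β0 ≤ β := (le_max_left _ _).trans hβ
  have hβ0' : 0 ≤ β := (le_max_right _ _).trans hβ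
  obtain ⟨h, c, C, hhm, hc, hch, hhC, hhA, hrow⟩ := hβ0 β hβ'
  obtain ⟨CG, hCG⟩ := hφ.bounded
  have hrow' : ∀ w ∈ (Set.univ : Set (OffIdx L → SU2)),
      ∫ w', (Set.univ : Set (OffIdx L → SU2)).indicator (fun w' => axialKernel β w w' * h w') w'
          ∂(Measure.pi fun _ : OffIdx L => haarProbability SU2)
        ≤ Real.exp (-(A * bareLambda ((L : ℝ) ^ 3 * β))) * levelValue su2Rep L β 0 * h w := fun w _ => by
    simp only [Set.indicator_univ]
    exact hrow w
  exact qform_le_of_axialRow hβ0' hφ.measurable hCG hφ.gaugeInv MeasurableSet.univ (fun k w => by simp) (fun w _ => Set.mem_univ w)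
    hhm hc hch hhC hhA hrow'

/-! ## §3 The Gram-nondegeneracy hypothesis of the no-intruder texts is free -/

/-- `InnerNoIntruderAt L δ` is equivalent to the same text with the Gram-nondegeneracy hypothesis deleted (a degenerate combination of bounded
measurable functions vanishes a.e.; then both sides of the conclusion are `0`). [folklore] -/
theorem innerNoIntruderAt_iff_dropGram (δ : ℝ → ℝ) :
    InnerNoIntruderAt L δ ↔
    (∀ k : ℕ, ∀ ε : ℝ, 0 < ε → ∃ β0 : ℝ, ∀ β : ℝ, β0 ≤ β →
      ∀ F : Fin (k + 1) → (GaugeConfig 3 L SU2 → ℝ), (∀ i, IsPhys (F i)) →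
        (∀ i U, F i U ≠ 0 → ∃ z : Fin 3 → Bool, orbitDist (TT.twist3 z U) < δ β) →
          ∃ a : Fin (k + 1) → ℝ, a ≠ 0 ∧
            qform su2Rep β (fun U => ∑ i, a i * F i U) (fun U => ∑ i, a i * F i U) * levelValue su2Rep 1 ((L : ℝ) ^ 3 * β) 0 ≤
              Real.exp (ε * bareLambda ((L : ℝ) ^ 3 * β)) * levelValue su2Rep 1 ((L : ℝ) ^ 3 * β) k * levelValue su2Rep L β 0 *
                l2 (fun U => ∑ i, a i * F i U) (fun U => ∑ i, a i * F i U)) := by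
  constructor
  · intro hI k ε hε
    obtain ⟨β0, hβ0⟩ := hI k ε hε
    refine ⟨β0, fun β hβ F hF hsupp => ?_⟩
    by_cases hGram : ∀ a : Fin (k + 1) → ℝ, a ≠ 0 → 0 < l2 (fun U => ∑ i, a i * F i U) (fun U => ∑ i, a i * F i U)
    · exact hβ0 β hβ F hF hsupp hGram
    · push Not at hGram
      obtain ⟨a, ha, hle⟩ := hGram
      refine ⟨a, ha, ?_⟩
      have hphys : IsPhys (fun U => ∑ i, a i * F i U) := isPhys_sum_mul_lat Finset.univ F hF a
      obtain ⟨C, hC⟩ := hphys.bounded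
      have hae : (fun U => ∑ i, a i * F i U) =ᵐ[configMeasure SU2 L] 0 :=
        ae_eq_zero_of_not_integral_mul_self_pos hphys.measurable hC (not_lt.mpr hle)
      have hq : qform su2Rep β (fun U => ∑ i, a i * F i U) (fun U => ∑ i, a i * F i U) = 0 :=
        integral_integral_eq_zero_of_ae_eq_zero hae _
      have hl : l2 (fun U => ∑ i, a i * F i U) (fun U => ∑ i, a i * F i U) = 0 := integral_mul_self_eq_zero_of_ae_eq_zero hae
      rw [hq, hl]; simp
  · intro hI k ε hε
    obtain ⟨β0, hβ0⟩ := hI k ε hε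
    exact ⟨β0, fun β hβ F hF hsupp _ => hβ0 β hβ F hF hsupp⟩

/-- A finite combination of bounded measurable functions is bounded and measurable. [folklore] -/
theorem comb_measurable_bounded {X : Type*} [MeasurableSpace X] {k : ℕ} {G : Fin (k + 1) → X → ℝ}
    (hGm : ∀ i, Measurable (G i)) (hGb : ∀ i, ∃ C : ℝ, ∀ x, |G i x| ≤ C) (a : Fin (k + 1) → ℝ) :
    Measurable (fun x => ∑ i, a i * G i x) ∧ ∃ C : ℝ, ∀ x, |∑ i, a i * G i x| ≤ C := by
  choose Cb hCb using hGb
  refine ⟨Finset.measurable_sum _ fun i _ => (hGm i).const_mul _, ∑ i, |a i| * Cb i, fun x => ?_⟩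
  refine (Finset.abs_sum_le_sum_abs _ _).trans (Finset.sum_le_sum fun i _ => ?_)
  rw [abs_mul]; exact mul_le_mul_of_nonneg_left (hCb i x) (abs_nonneg _)

/-- `InnerNoIntruderOneOrbitAt L δ` is equivalent to the same text with the Gram-nondegeneracy hypothesis deleted. [folklore] -/
theorem innerNoIntruderOneOrbitAt_iff_dropGram (δ : ℝ → ℝ) :
    InnerNoIntruderOneOrbitAt L δ ↔
    (∀ k : ℕ, ∀ ε : ℝ, 0 < ε → ∃ β0 : ℝ, ∀ β : ℝ, β0 ≤ β →
      ∀ G : Fin (k + 1) → (GaugeConfig 3 L SU2 → ℝ),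
        (∀ i, Measurable (G i)) → (∀ i, ∃ C : ℝ, ∀ U, |G i U| ≤ C) →
        (∀ i (g : Site 3 L → SU2) (U : GaugeConfig 3 L SU2), G i (gaugeTransform g U) = G i U) →
        (∀ i U, G i U ≠ 0 → orbitDist U < δ β) →
          ∃ a : Fin (k + 1) → ℝ, a ≠ 0 ∧
            qform su2Rep β (fun U => ∑ i, a i * G i U) (fun U => ∑ i, a i * G i U) * levelValue su2Rep 1 ((L : ℝ) ^ 3 * β) 0 ≤
              Real.exp (ε * bareLambda ((L : ℝ) ^ 3 * β)) * levelValue su2Rep 1 ((L : ℝ) ^ 3 * β) k * levelValue su2Rep L β 0 *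
                l2 (fun U => ∑ i, a i * G i U) (fun U => ∑ i, a i * G i U)) := by
  constructor
  · intro hI k ε hε
    obtain ⟨β0, hβ0⟩ := hI k ε hε
    refine ⟨β0, fun β hβ G hGm hGb hGg hsupp => ?_⟩
    by_cases hGram : ∀ a : Fin (k + 1) → ℝ, a ≠ 0 → 0 < l2 (fun U => ∑ i, a i * G i U) (fun U => ∑ i, a i * G i U)
    · exact hβ0 β hβ G hGm hGb hGg hsupp hGram
    · push Not at hGram
      obtain ⟨a, ha, hle⟩ := hGram
      refine ⟨a, ha, ?_⟩
      obtain ⟨hm, C, hC⟩ := comb_measurable_bounded hGm hGb a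
      have hae : (fun U => ∑ i, a i * G i U) =ᵐ[configMeasure SU2 L] 0 :=
        ae_eq_zero_of_not_integral_mul_self_pos hm hC (not_lt.mpr hle)
      have hq : qform su2Rep β (fun U => ∑ i, a i * G i U) (fun U => ∑ i, a i * G i U) = 0 :=
        integral_integral_eq_zero_of_ae_eq_zero hae _
      have hl : l2 (fun U => ∑ i, a i * G i U) (fun U => ∑ i, a i * G i U) = 0 := integral_mul_self_eq_zero_of_ae_eq_zero hae
      rw [hq, hl]; simp
  · intro hI k ε hε
    obtain ⟨β0, hβ0⟩ := hI k ε hε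
    exact ⟨β0, fun β hβ G hGm hGb hGg hsupp _ => hβ0 β hβ G hGm hGb hGg hsupp⟩

/-- `InnerNoIntruderAxialAt L δ` (C4) is equivalent to the same text with the Gram-nondegeneracy hypothesis (in `L²(Haar^{off})`) deleted. [folklore] -/
theorem innerNoIntruderAxialAt_iff_dropGram (δ : ℝ → ℝ) :
    InnerNoIntruderAxialAt L δ ↔
    (∀ k : ℕ, ∀ ε : ℝ, 0 < ε → ∃ β0 : ℝ, ∀ β : ℝ, β0 ≤ β →
      ∀ g : Fin (k + 1) → ((OffIdx L → SU2) → ℝ),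
        (∀ i, Measurable (g i)) → (∀ i, ∃ C : ℝ, ∀ w, |g i w| ≤ C) →
        (∀ i (k' : SU2) (w : OffIdx L → SU2), g i (fun j => k' * w j * k'⁻¹) = g i w) →
        (∀ i w, g i w ≠ 0 → ∀ j : OffIdx L, frobNorm ((w j : Matrix (Fin 2) (Fin 2) ℂ) - 1) ≤ (6 * L + 1) * δ β) →
          ∃ a : Fin (k + 1) → ℝ, a ≠ 0 ∧
            (∫ w, ∫ w', (∑ i, a i * g i w) * axialKernel β w w' * (∑ i, a i * g i w')
                ∂(Measure.pi fun _ : OffIdx L => haarProbability SU2) ∂(Measure.pi fun _ : OffIdx L => haarProbability SU2)) *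
              levelValue su2Rep 1 ((L : ℝ) ^ 3 * β) 0 ≤
            Real.exp (ε * bareLambda ((L : ℝ) ^ 3 * β)) * levelValue su2Rep 1 ((L : ℝ) ^ 3 * β) k * levelValue su2Rep L β 0 *
              ∫ w, (∑ i, a i * g i w) * (∑ i, a i * g i w) ∂(Measure.pi fun _ : OffIdx L => haarProbability SU2)) := by
  constructor
  · intro hI k ε hε
    obtain ⟨β0, hβ0⟩ := hI k ε hε
    refine ⟨β0, fun β hβ g hgm hgb hgA hsupp => ?_⟩
    by_cases hGram : ∀ a : Fin (k + 1) → ℝ, a ≠ 0 →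
        0 < ∫ w, (∑ i, a i * g i w) * (∑ i, a i * g i w) ∂(Measure.pi fun _ : OffIdx L => haarProbability SU2)
    · exact hβ0 β hβ g hgm hgb hgA hsupp hGram
    · push Not at hGram
      obtain ⟨a, ha, hle⟩ := hGram
      refine ⟨a, ha, ?_⟩
      obtain ⟨hm, C, hC⟩ := comb_measurable_bounded hgm hgb a
      have hae : (fun w => ∑ i, a i * g i w) =ᵐ[Measure.pi fun _ : OffIdx L => haarProbability SU2] 0 :=
        ae_eq_zero_of_not_integral_mul_self_pos hm hC (not_lt.mpr hle)
      rw [integral_integral_eq_zero_of_ae_eq_zero hae (axialKernel β), integral_mul_self_eq_zero_of_ae_eq_zero hae]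
      simp
  · intro hI k ε hε
    obtain ⟨β0, hβ0⟩ := hI k ε hε
    exact ⟨β0, fun β hβ g hgm hgb hgA hsupp _ => hβ0 β hβ g hgm hgb hgA hsupp⟩

/-! ## §4 Degenerate instances that hold (normalisation audit) -/

/-- The `k = 0` clause of `BOUpperAt L` holds for every `L`: `λ₀μ₀ ≤ e^{ελ_b(L³β)}·(μ₀λ₀)` for `β ≥ 1`. [folklore] -/
theorem boUpper_level_zero {ε : ℝ} (hε : 0 < ε) : ∃ β0 : ℝ, ∀ β : ℝ, β0 ≤ β →
    levelValue su2Rep L β 0 * levelValue su2Rep 1 ((L : ℝ) ^ 3 * β) 0 ≤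
      Real.exp (ε * bareLambda ((L : ℝ) ^ 3 * β)) * (levelValue su2Rep 1 ((L : ℝ) ^ 3 * β) 0 * levelValue su2Rep L β 0) := by
  refine ⟨1, fun β hβ => ?_⟩
  have hL : (0 : ℝ) < L := by exact_mod_cast Nat.pos_of_ne_zero (NeZero.ne L)
  have hB : 0 < (L : ℝ) ^ 3 * β := by positivity
  have hlam : 0 < bareLambda ((L : ℝ) ^ 3 * β) := bareLambda_pos' hB
  have h1 : 1 ≤ Real.exp (ε * bareLambda ((L : ℝ) ^ 3 * β)) := by
    nlinarith [Real.add_one_le_exp (ε * bareLambda ((L : ℝ) ^ 3 * β)), mul_pos hε hlam]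
  have hp : 0 ≤ levelValue su2Rep 1 ((L : ℝ) ^ 3 * β) 0 * levelValue su2Rep L β 0 :=
    mul_nonneg (levelValue_zero_su2Rep_pos 1 _).le (levelValue_zero_su2Rep_pos L β).le
  nlinarith

/-- The `k = 0` clause of `InnerNoIntruderAt L δ` holds for every `L` and every scale `δ` (decoration): with `a = 1` the combination is the physical
`F₀` itself and `⟨F₀,K_βF₀⟩ ≤ λ₀‖F₀‖²` (`qform_le_levelValue_zero_mul`), while `e^{ελ_b} ≥ 1`, `μ₀ > 0`. [cite: ReedSimonIV1978, Thm. XIII.1] -/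
theorem innerNoIntruder_level_zero (δ : ℝ → ℝ) {ε : ℝ} (hε : 0 < ε) : ∃ β0 : ℝ, ∀ β : ℝ, β0 ≤ β →
    ∀ F : Fin (0 + 1) → (GaugeConfig 3 L SU2 → ℝ), (∀ i, IsPhys (F i)) →
      (∀ i U, F i U ≠ 0 → ∃ z : Fin 3 → Bool, orbitDist (TT.twist3 z U) < δ β) →
      (∀ a : Fin (0 + 1) → ℝ, a ≠ 0 → 0 < l2 (fun U => ∑ i, a i * F i U) (fun U => ∑ i, a i * F i U)) →
        ∃ a : Fin (0 + 1) → ℝ, a ≠ 0 ∧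
          qform su2Rep β (fun U => ∑ i, a i * F i U) (fun U => ∑ i, a i * F i U) * levelValue su2Rep 1 ((L : ℝ) ^ 3 * β) 0 ≤
            Real.exp (ε * bareLambda ((L : ℝ) ^ 3 * β)) * levelValue su2Rep 1 ((L : ℝ) ^ 3 * β) 0 * levelValue su2Rep L β 0 *
              l2 (fun U => ∑ i, a i * F i U) (fun U => ∑ i, a i * F i U) := by
  refine ⟨1, fun β hβ F hF _ hGram => ?_⟩
  have hL : (0 : ℝ) < L := by exact_mod_cast Nat.pos_of_ne_zero (NeZero.ne L)
  have hB : 0 < (L : ℝ) ^ 3 * β := by positivity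
  have hlam : 0 < bareLambda ((L : ℝ) ^ 3 * β) := bareLambda_pos' hB
  have h1 : 1 ≤ Real.exp (ε * bareLambda ((L : ℝ) ^ 3 * β)) := by
    nlinarith [Real.add_one_le_exp (ε * bareLambda ((L : ℝ) ^ 3 * β)), mul_pos hε hlam]
  have hμ0 : 0 < levelValue su2Rep 1 ((L : ℝ) ^ 3 * β) 0 := levelValue_zero_su2Rep_pos 1 _
  set a : Fin (0 + 1) → ℝ := fun _ => 1 with hadef
  have ha : a ≠ 0 := fun h => by have := congr_fun h 0; simp [hadef] at this
  have hphys : IsPhys (fun U => ∑ i, a i * F i U) := isPhys_sum_mul_lat Finset.univ F hF a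
  have hpos := hGram a ha
  have hq := qform_le_levelValue_zero_mul su2Rep continuous_su2Rep β hphys hpos
  refine ⟨a, ha, ?_⟩
  have hQ : qform su2Rep β (fun U => ∑ i, a i * F i U) (fun U => ∑ i, a i * F i U) * levelValue su2Rep 1 ((L : ℝ) ^ 3 * β) 0 ≤
      levelValue su2Rep L β 0 * l2 (fun U => ∑ i, a i * F i U) (fun U => ∑ i, a i * F i U) * levelValue su2Rep 1 ((L : ℝ) ^ 3 * β) 0 :=
    mul_le_mul_of_nonneg_right hq hμ0.le
  have hnn : 0 ≤ levelValue su2Rep L β 0 * l2 (fun U => ∑ i, a i * F i U) (fun U => ∑ i, a i * F i U) * levelValue su2Rep 1 ((L : ℝ) ^ 3 * β) 0 :=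
    mul_nonneg (mul_nonneg (levelValue_zero_su2Rep_pos L β).le hpos.le) hμ0.le
  nlinarith

/-- **`BO_up(1)` holds**: at `L = 1` the natural coupling is `B' = 1³β = β`, both sides carry the same one-site levels, and `e^{ελ_b(β)} ≥ 1`
(`β ≥ 1`).  Normalisation check of the text `BOUpperAt`. [folklore] -/
theorem boUpperAt_one : BOUpperAt 1 := by
  intro k ε hε
  refine ⟨1, fun β hβ => ?_⟩
  simp only [Nat.cast_one, one_pow, one_mul]
  have hβ0 : 0 < β := by linarith
  have hlam : 0 < bareLambda β := bareLambda_pos' hβ0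
  have h1 : 1 ≤ Real.exp (ε * bareLambda β) := by nlinarith [Real.add_one_le_exp (ε * bareLambda β), mul_pos hε hlam]
  have hp : 0 ≤ levelValue su2Rep 1 β k * levelValue su2Rep 1 β 0 :=
    mul_nonneg (levelValue_su2Rep_nonneg 1 hβ0.le k) (levelValue_zero_su2Rep_pos 1 β).le
  nlinarith

/-- **`I(1)` holds at every scale**: at `L = 1` the text `InnerNoIntruderAt 1 δ` is the max–min principle — if every nonzero combination `ψ` of a
Gram-nondegenerate physical `(k+1)`-family had `⟨ψ,Kψ⟩·μ₀ > e^{ελ_b}·μ_k·μ₀·‖ψ‖²`, the family form of the lower-bound principle would give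
`e^{ελ_b}μ_k ≤ μ_k`, impossible (`μ_k > 0`, `λ_b > 0`); the support clause is void there.  Normalisation check of the text. [cite: ReedSimonIV1978, Thm. XIII.1] -/
theorem innerNoIntruderAt_one (δ : ℝ → ℝ) : InnerNoIntruderAt 1 δ := by
  intro k ε hε
  refine ⟨1, fun β hβ F hF _ hGram => ?_⟩
  simp only [Nat.cast_one, one_pow, one_mul]
  have hβ0 : 0 < β := by linarith
  have hlam : 0 < bareLambda β := bareLambda_pos' hβ0
  have hm0 : 0 < levelValue su2Rep 1 β 0 := levelValue_zero_su2Rep_pos 1 β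
  have hmk : 0 < levelValue su2Rep 1 β k := levelValue_su2Rep_pos hβ0 k
  have hexp : 1 < Real.exp (ε * bareLambda β) := Real.one_lt_exp_iff.mpr (mul_pos hε hlam)
  by_contra H
  push Not at H
  have hs : ∀ a : Fin (k + 1) → ℝ,
      Real.exp (ε * bareLambda β) * levelValue su2Rep 1 β k * l2 (fun U => ∑ i, a i * F i U) (fun U => ∑ i, a i * F i U) ≤
        qform su2Rep β (fun U => ∑ i, a i * F i U) (fun U => ∑ i, a i * F i U) := by
    intro a
    by_cases ha : a = 0
    · subst ha
      simp [l2, qform]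
    · have h := H a ha
      have h' : (Real.exp (ε * bareLambda β) * levelValue su2Rep 1 β k *
          l2 (fun U => ∑ i, a i * F i U) (fun U => ∑ i, a i * F i U)) * levelValue su2Rep 1 β 0 <
          qform su2Rep β (fun U => ∑ i, a i * F i U) (fun U => ∑ i, a i * F i U) * levelValue su2Rep 1 β 0 := by linarith
      exact (lt_of_mul_lt_mul_right h' hm0.le).le
  have hle := le_levelValue_of_family β F hF hGram hs
  nlinarith

/-! ## §5 Monotonicity in the scales -/

/-- `InnerNoIntruderAt` is antitone in the scale: a smaller inner region is easier. [folklore] -/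
theorem innerNoIntruderAt_anti {δ δ' : ℝ → ℝ} (hle : ∀ β, δ' β ≤ δ β) (hI : InnerNoIntruderAt L δ) : InnerNoIntruderAt L δ' := by
  intro k ε hε
  obtain ⟨β0, hβ0⟩ := hI k ε hε
  refine ⟨β0, fun β hβ F hF hsupp hGram => hβ0 β hβ F hF (fun i U hU => ?_) hGram⟩
  obtain ⟨z, hz⟩ := hsupp i U hU
  exact ⟨z, lt_of_lt_of_le hz (hle β)⟩

/-- `InnerNoIntruderOneOrbitAt` is antitone in the scale. [folklore] -/
theorem innerNoIntruderOneOrbitAt_anti {δ δ' : ℝ → ℝ} (hle : ∀ β, δ' β ≤ δ β) (hI : InnerNoIntruderOneOrbitAt L δ) :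
    InnerNoIntruderOneOrbitAt L δ' := by
  intro k ε hε
  obtain ⟨β0, hβ0⟩ := hI k ε hε
  exact ⟨β0, fun β hβ G hGm hGb hGg hsupp hGram =>
    hβ0 β hβ G hGm hGb hGg (fun i U hU => lt_of_lt_of_le (hsupp i U hU) (hle β)) hGram⟩

/-- `InnerNoIntruderAxialAt` (C4) is antitone in the scale: a smaller comb box is easier. [folklore] -/
theorem innerNoIntruderAxialAt_anti {δ δ' : ℝ → ℝ} (hle : ∀ β, δ' β ≤ δ β) (hI : InnerNoIntruderAxialAt L δ) :
    InnerNoIntruderAxialAt L δ' := by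
  intro k ε hε
  obtain ⟨β0, hβ0⟩ := hI k ε hε
  refine ⟨β0, fun β hβ g hgm hgb hgA hsupp hGram => hβ0 β hβ g hgm hgb hgA (fun i w hw j => ?_) hGram⟩
  have hL : (0 : ℝ) ≤ 6 * L + 1 := by positivity
  exact (hsupp i w hw j).trans (mul_le_mul_of_nonneg_left (hle β) hL)

/-- `ValleyGainAt` is monotone in the region: a larger exclusion radius `δ' ≥ δ` and a smaller action threshold `η' ≤ η` are easier. [folklore] -/
theorem valleyGainAt_mono {δ δ' η η' : ℝ → ℝ} (hδ : ∀ β, δ β ≤ δ' β) (hη : ∀ β, η' β ≤ η β) (hV : ValleyGainAt L δ η) :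
    ValleyGainAt L δ' η' := by
  intro A
  obtain ⟨β0, hβ0⟩ := hV A
  refine ⟨β0, fun β hβ φ hφ hsupp => hβ0 β hβ φ hφ fun U hU => ?_⟩
  obtain ⟨hS, hO⟩ := hsupp U hU
  exact ⟨by linarith [hη β], fun z => by linarith [hO z, hδ β]⟩

end Summit.QuantumFields.YangMills.Theorems.TwistedTraceScaling.Negative.R6

end
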